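import Literature.NumberTheory.DiophantineGeometry.GenEllPullbackConductor
import Literature.NumberTheory.DiophantineGeometry.GenEllProjLineInvariance
import Literature.NumberTheory.DiophantineGeometry.GenEllThm21
import Literature.NumberTheory.EllipticCurves.HeightsBaseChangeProofs
import HarnessLib

/-!
# [GenEll] Thm. 2.1, proof: re-presenting the image `γ(x)` of a point of `ℙ¹` over its minimal field

S. Mochizuki, *Arithmetic elliptic curves in general position*, Math. J. Okayama Univ. 52 (2010)
[cite: MochizukiGenEll2010, Thm 2.1 pp.11–13]. The proof of Thm. 2.1 transfers the Vojta inequality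
along finite maps of curves; every auxiliary point (`z = φ(P)`, `γ(x)`) is a point of `U_X(Q̄)^{≤d}`
"regarded over its minimal field of definition" (Def. 1.5 (i) p. 8: the functions `log-diff`,
`log-cond` are evaluated over `F_min`). In the tree's vocabulary (`GenEllProjLine`: a point is a
PRESENTATION `(F, x)`; `UPle d` demands `ℚ(x) = F`) this re-presentation must be carried out
explicitly. This file does it once and for all: for a presented point `P = (F, x)` and an element
`y ∈ F` (typically `y = γ(x)` for a rational map `γ`), `P.imageAt y := (ℚ(y), y)` with
`ℚ(y) ⊆ F` Mathlib's `IntermediateField.adjoin ℚ {y}`, together with the inclusion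
`P.imageEmb y : ℚ(y) →+* F`, and PROVES: the re-presented point is minimal, of degree `≤ [F:ℚ]`,
lies in `U` iff `y ≠ 0, 1`; its normalised height is the absolute height of `y`
(`ht_imageAt : ht(ℚ(y), y) = h_F(y)/[F:ℚ]`, Bombieri–Gubler Lemma 1.5.2 via the tree's
`NumberField.logHeight₁_map_ringHom`); its log-different is at most that of `P`
(`logDiff_imageAt_le`, [GenEll] Prop. 1.7 (i) monotonicity `logdisc ℚ(y) ≤ logdisc F`); and every
complex (resp. `Q̄_p`-) embedding of `ℚ(y)` extends to one of `F`, so conditions "on all conjugates of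
`y`" stated with the embeddings of `F` descend to the re-presented point
(`imageAt_forall_embedding`). Classical bookkeeping; abc-iut cell, route item GenEllTwo
(stmt-ABC-19679), work package W2 of the cell's ℙ¹-route note; nothing here is disputed and nothing
bears on [IUTchIII] Cor. 3.12.
-/

noncomputable section

open NumberField IsDedekindDomain Height Polynomial

namespace Literature.NumberTheory.DiophantineGeometry.GenEll

namespace NFPoint

/-- The point `y ∈ F` of `ℙ¹(F)` RE-PRESENTED over its minimal field of definition `ℚ(y) ⊆ F`
([GenEll] Def. 1.5 (i) p. 8: "`F` … a minimal field of definition"): the presentation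
`(ℚ(y), y)`. [cite: MochizukiGenEll2010, Def 1.5 (i) p.8] -/
def imageAt (P : NFPoint) (y : P.F) : NFPoint where
  F := ↥(IntermediateField.adjoin ℚ ({y} : Set P.F))
  x := ⟨y, IntermediateField.mem_adjoin_simple_self ℚ y⟩

/-- The inclusion `ℚ(y) ⊆ F` of presenting fields. [cite: MochizukiGenEll2010, Def 1.5 (i) p.8] -/
def imageEmb (P : NFPoint) (y : P.F) : (P.imageAt y).F →+* P.F :=
  algebraMap (↥(IntermediateField.adjoin ℚ ({y} : Set P.F))) P.F

/-- The inclusion sends the re-presented coordinate to `y`. [cite: MochizukiGenEll2010, Def 1.5 (i) p.8] -/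
@[simp] theorem imageEmb_x (P : NFPoint) (y : P.F) : P.imageEmb y (P.imageAt y).x = y := rfl

/-- The inclusion is injective (a homomorphism of fields). [cite: MochizukiGenEll2010, Def 1.5 (i) p.8] -/
theorem imageEmb_injective (P : NFPoint) (y : P.F) : Function.Injective (P.imageEmb y) :=
  (P.imageEmb y).injective

/-- `(ℚ(y), y)` is a minimal presentation: `ℚ(y)` is generated by `y`. [cite: MochizukiGenEll2010, Def 1.5 (i) p.8] -/
theorem imageAt_isMinimal (P : NFPoint) (y : P.F) : (P.imageAt y).IsMinimal := by
  rw [isMinimal_iff_natDegree]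
  have hint : IsIntegral ℚ y := Algebra.IsIntegral.isIntegral y
  -- the minimal polynomial of the re-presented coordinate is that of `y`
  have h1 : minpoly ℚ (P.imageAt y).x = minpoly ℚ y := by
    have h := minpoly.algHom_eq (P.imageEmb y).toRatAlgHom (P.imageEmb_injective y)
      (P.imageAt y).x
    rw [← h]
    rfl
  rw [h1]
  -- `[ℚ(y):ℚ] = deg minpoly(y)` (the two `ℚ`-module structures on `ℚ(y)` agree: subsingleton)
  have h2 : Module.finrank ℚ ↥(IntermediateField.adjoin ℚ ({y} : Set P.F)) =
      (minpoly ℚ y).natDegree := IntermediateField.adjoin.finrank hint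
  unfold degree
  change (minpoly ℚ y).natDegree = Module.finrank ℚ ↥(IntermediateField.adjoin ℚ ({y} : Set P.F))
  convert h2.symm using 3

/-- `[ℚ(y):ℚ] ≤ [F:ℚ]`: the re-presented point has degree at most that of the presentation it came
from ([GenEll] Ex. 1.3 (i): points of degree `≤ d`). [cite: MochizukiGenEll2010, Ex 1.3 (i) p.5] -/
theorem degree_imageAt_le (P : NFPoint) (y : P.F) : (P.imageAt y).degree ≤ P.degree :=
  LinearMap.finrank_le_finrank_of_injective (f := (P.imageEmb y).toRatAlgHom.toLinearMap)
    (P.imageEmb_injective y)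

/-- The re-presented point lies in `U = ℙ¹ ∖ {0,1,∞}` iff `y ≠ 0, 1`. [cite: MochizukiGenEll2010, Def 1.5 (i) p.8] -/
theorem imageAt_inU_iff (P : NFPoint) (y : P.F) : (P.imageAt y).InU ↔ (y ≠ 0 ∧ y ≠ 1) := by
  have hinj := P.imageEmb_injective y
  constructor
  · rintro ⟨h0, h1⟩
    refine ⟨fun h => h0 (hinj ?_), fun h => h1 (hinj ?_)⟩
    · rw [imageEmb_x, h, map_zero]
    · rw [imageEmb_x, h, map_one]
  · rintro ⟨h0, h1⟩
    refine ⟨fun h => h0 ?_, fun h => h1 ?_⟩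
    · rw [← P.imageEmb_x y, h, map_zero]
    · rw [← P.imageEmb_x y, h, map_one]

/-- The re-presented point lies in `U_P(Q̄)^{≤d}` as soon as `y ≠ 0, 1` and `[F:ℚ] ≤ d`.
[cite: MochizukiGenEll2010, Ex 1.3 (i) p.5] -/
theorem imageAt_mem_UPle (P : NFPoint) {y : P.F} (h0 : y ≠ 0) (h1 : y ≠ 1) {d : ℕ}
    (hd : P.degree ≤ d) : P.imageAt y ∈ UPle d :=
  ⟨⟨(P.imageAt_inU_iff y).mpr ⟨h0, h1⟩, P.imageAt_isMinimal y⟩, (P.degree_imageAt_le y).trans hd⟩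

/-- **The normalised height of the re-presented point is the absolute height of `y`**:
`ht(ℚ(y), y) = h_F(y)/[F:ℚ]` (Bombieri–Gubler Lemma 1.5.2, independence of the absolute height of
the field; [GenEll] p. 4 "any morphism that gives rise to `x`"). [cite: MochizukiGenEll2010, Def 1.2 (i) p.5] -/
theorem ht_imageAt (P : NFPoint) (y : P.F) :
    (P.imageAt y).ht = (P.degree : ℝ)⁻¹ * logHeight₁ y := by
  have h := NumberField.logHeight₁_map_ringHom (P.imageEmb y) (P.imageAt y).x
  rw [imageEmb_x] at h
  -- `h : [ℚ(y):ℚ] · h_F(y) = [F:ℚ] · h_{ℚ(y)}(y)`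
  have hQ : (0 : ℝ) < (P.imageAt y).degree := Nat.cast_pos.mpr (P.imageAt y).degree_pos
  have hP : (0 : ℝ) < P.degree := Nat.cast_pos.mpr P.degree_pos
  unfold ht
  change ((P.imageAt y).degree : ℝ)⁻¹ * logHeight₁ (P.imageAt y).x = (P.degree : ℝ)⁻¹ * logHeight₁ y
  change ((P.imageAt y).degree : ℝ) * logHeight₁ y = (P.degree : ℝ) * logHeight₁ (P.imageAt y).x at h
  field_simp
  linarith

/-- **The log-different does not increase under re-presentation**: `log-diff(ℚ(y), y) ≤ log-diff(F, x)`
(`ℚ(y) ⊆ F`; [GenEll] Prop. 1.7 (i), left, constant `0`). [cite: MochizukiGenEll2010, Prop 1.7 (i) p.10] -/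
theorem logDiff_imageAt_le (P : NFPoint) (y : P.F) : (P.imageAt y).logDiff ≤ P.logDiff :=
  logDiff_le_logDiff_of_ringHom (P.imageAt y) P (P.imageEmb y)

/-- **Conditions on all conjugates descend to the re-presented point (archimedean)**: every
embedding `τ : ℚ(y) → ℂ` extends to an embedding `σ : F → ℂ` (`ℂ` algebraically closed, `F/ℚ(y)`
algebraic), so `σ(y)` ranges over all `τ(y)` — "the set of `[F:ℚ]` points of `X^arc` determined by
`x`" contains the set determined by the re-presented point. [cite: MochizukiGenEll2010, Ex 1.3 (ii) p.6] -/
theorem imageAt_forall_embedding (P : NFPoint) (y : P.F) {Q : ℂ → Prop}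
    (h : ∀ σ : P.F →+* ℂ, Q (σ y)) : ∀ τ : (P.imageAt y).F →+* ℂ, Q (τ (P.imageAt y).x) := by
  intro τ
  letI : Algebra (P.imageAt y).F ℂ := τ.toAlgebra
  letI : Algebra (P.imageAt y).F P.F := (P.imageEmb y).toAlgebra
  haveI : Algebra.IsAlgebraic (P.imageAt y).F P.F := Algebra.IsAlgebraic.of_finite _ _
  let σ : P.F →ₐ[(P.imageAt y).F] ℂ := IsAlgClosed.lift
  have hσ : σ y = τ (P.imageAt y).x := σ.commutes (P.imageAt y).x
  have hh := h (σ : P.F →+* ℂ)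
  rw [show ((σ : P.F →+* ℂ) y) = σ y from rfl, hσ] at hh
  exact hh

/-- The same at a prime `p`: every embedding `ℚ(y) → Q̄_p` extends to `F → Q̄_p` ("the set of `[F:ℚ]`
points of `X(Q̄_v)` determined by `x`"). [cite: MochizukiGenEll2010, Ex 1.3 (ii) p.6] -/
theorem imageAt_forall_embedding_padic (P : NFPoint) (y : P.F) (p : ℕ) [Fact p.Prime]
    {Q : PadicAlgCl p → Prop} (h : ∀ σ : P.F →+* PadicAlgCl p, Q (σ y)) :
    ∀ τ : (P.imageAt y).F →+* PadicAlgCl p, Q (τ (P.imageAt y).x) := by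
  intro τ
  letI : Algebra (P.imageAt y).F (PadicAlgCl p) := τ.toAlgebra
  letI : Algebra (P.imageAt y).F P.F := (P.imageEmb y).toAlgebra
  haveI : Algebra.IsAlgebraic (P.imageAt y).F P.F := Algebra.IsAlgebraic.of_finite _ _
  let σ : P.F →ₐ[(P.imageAt y).F] PadicAlgCl p := IsAlgClosed.lift
  have hσ : σ y = τ (P.imageAt y).x := σ.commutes (P.imageAt y).x
  have hh := h (σ : P.F →+* PadicAlgCl p)
  rw [show ((σ : P.F →+* PadicAlgCl p) y) = σ y from rfl, hσ] at hh
  exact hh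

end NFPoint

end Literature.NumberTheory.DiophantineGeometry.GenEll

end
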